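import Summits.RiemannHypothesis.RiemannHypothesis.Theorems.WeilTwoPrimeDeflE25EBase
import Literature.NumberTheory.LFunctions.WeilBlockRows
import Literature.NumberTheory.LFunctions.WeilBlockRowsDCFast
import HarnessLib

/-!
# Even-sector deflated two-prime certificate E25E: rows 120–123 of the even check `D C = I`

`WeilCert.checkDCRow 0` for certificate E25E, row by row via the linear-traversal check `WeilCert.checkDCRowF` (`decide +kernel`) and `WeilCert.checkDCRow_of_F`. Pure proof file.
-/

set_option linter.dupNamespace false

noncomputable section

namespace Summit.RiemannHypothesis.RiemannHypothesis.Theorems.EvenWinsBeyondArch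

open Literature.NumberTheory.LFunctions

set_option maxHeartbeats 0 in
/-- Fast kernel check of row 120 of the even `D C = I` (certificate E25E; linear traversals). [folklore] -/
theorem checkDCRowF0_120_weilCertDeflE25E : weilCertDeflE25EBase.checkDCRowF 0 120 = true := by
  decide +kernel

/-- Row 120 of the even `D C = I` (certificate E25E), from the fast check. [folklore] -/
theorem checkDCRow0_120_weilCertDeflE25E : weilCertDeflE25EBase.checkDCRow 0 120 = true :=
  WeilCert.checkDCRow_of_F checkDCRowF0_120_weilCertDeflE25E

set_option maxHeartbeats 0 in
/-- Fast kernel check of row 121 of the even `D C = I` (certificate E25E; linear traversals). [folklore] -/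
theorem checkDCRowF0_121_weilCertDeflE25E : weilCertDeflE25EBase.checkDCRowF 0 121 = true := by
  decide +kernel

/-- Row 121 of the even `D C = I` (certificate E25E), from the fast check. [folklore] -/
theorem checkDCRow0_121_weilCertDeflE25E : weilCertDeflE25EBase.checkDCRow 0 121 = true :=
  WeilCert.checkDCRow_of_F checkDCRowF0_121_weilCertDeflE25E

set_option maxHeartbeats 0 in
/-- Fast kernel check of row 122 of the even `D C = I` (certificate E25E; linear traversals). [folklore] -/
theorem checkDCRowF0_122_weilCertDeflE25E : weilCertDeflE25EBase.checkDCRowF 0 122 = true := by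
  decide +kernel

/-- Row 122 of the even `D C = I` (certificate E25E), from the fast check. [folklore] -/
theorem checkDCRow0_122_weilCertDeflE25E : weilCertDeflE25EBase.checkDCRow 0 122 = true :=
  WeilCert.checkDCRow_of_F checkDCRowF0_122_weilCertDeflE25E

set_option maxHeartbeats 0 in
/-- Fast kernel check of row 123 of the even `D C = I` (certificate E25E; linear traversals). [folklore] -/
theorem checkDCRowF0_123_weilCertDeflE25E : weilCertDeflE25EBase.checkDCRowF 0 123 = true := by
  decide +kernel

/-- Row 123 of the even `D C = I` (certificate E25E), from the fast check. [folklore] -/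
theorem checkDCRow0_123_weilCertDeflE25E : weilCertDeflE25EBase.checkDCRow 0 123 = true :=
  WeilCert.checkDCRow_of_F checkDCRowF0_123_weilCertDeflE25E


end Summit.RiemannHypothesis.RiemannHypothesis.Theorems.EvenWinsBeyondArch
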